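import Summits.BirchSwinnertonDyer.BirchSwinnertonDyer.Theorems.KatoDescentTamePotSupersingularTameUpperDefectBillCount
import Summits.BirchSwinnertonDyer.BirchSwinnertonDyer.Theorems.KatoDescentTamePotSupersingularTameUpperNonsurjSharpNodes
import HarnessLib

/-!
# Route `KatoDescentTamePotSupersingular` (rung K8, sub-rung B4 (t′), cell `bsd-potss`): the U₀ BILL v7 of item
# stmt-BirchSwinnertonDyer-19982 `TameUpperDefectRankZero` — BY NAME from held / closed route items, the
# Kolyvagin–Jetchev SHARP INDEX BOUND on the ♯ rows (displayed) and Coates–Sujatha's (A) on the MANIN-DIRTY rows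
# only (a `--supports … --as helper` file; seat `bsd-potss-k8t-c4` g6; nothing booked, BSD is not proved by any of
# this, the item is NOT closed)

After g5's bill v6 (`tameUpperDefectRankZero_of_cruxA_of_heldItems`) the only non-cite, non-closed input of U₀
was crux 19413 `TameFineSelmerCoatesSujatha` = (A) on ALL non-CM U₀-ns rows. This bill shows where (A) is really
needed once the Heegner road is granted its sharp form: composing the split glue 19204
(`tameUpperDefectOfSplit_proof`), the closed glue 19712 (`tameUpperReducibleDefectOfCountInputs_proof`, from the six
HELD cite-level `…RedT` children of U₀-red 19203), and this seat's route-free assembly of the U₀-ns BODY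
(`TameUpperHeegnerSharpRoad.upperNonsurjTower_of_lower_of_rankOne_of_sharpIndexBound_of_fineSelmerManin`,
p471788), U₀ follows BY NAME from: the route items L₀ `TameLowerHalfRankZero` (19981, deciding crux), the residual
`TameRankOne` (19984), `KatoTamagawaExactInputs` (19191), `PublishedInputsFineSelmerCM` (19387), the six `…RedT`
children; the Heegner-road published facts (`gross_zagier`, `kolyvagin`, Matar–Nekovář's irreducible Kolyvagin
bound, `exists_isNewformOf`, Bump–Friedberg–Hoffstein); the displayed schema `hJ` (Kolyvagin–Jetchev sharp index
bound on the non-CM ♯ rows with `ρ̄` not onto and a Manin-clean datum: Jetchev 2008 Thm. 1.4 / Cor. 1.5 in the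
irreducible reading of his Remark 6.2 + Matar–Nekovář 2019 §0.11 on the 87 / 90 census rows with ONE Tamagawa-`p`
prime, Jetchev's Conj. 1.3 on the other 3 — kit job j261522; NOT a published theorem, NOT asserted); and (A) ONLY
on the Manin-dirty rows (`hCS`; census-empty by Cremona's Manin table + `α ∣ deg ψ`, class-wide = the Manin
conjecture). HONEST FRAMING: conditional over items and displayed hypotheses; nothing asserted; no item is closed;
BSD is not advanced by this bookkeeping.

References: [Jetchev2008] Thm. 1.4, Cor. 1.5, Rem. 6.2; [MatarNekovar2019] Thm. 0.3, §0.11; [Kato2004Asterisque]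
Thm. 14.5 (3), (14.9.3), Prop. 14.16; [CoatesSujatha2005] Conj. A; [BurungaleFlach2024] Cor. 2; [GrossZagier1986];
[BumpFriedbergHoffstein1990]; [Cassels1965ArithmeticVIII].
-/

set_option autoImplicit false
-- sibling precedent (`KatoDescentTamePotSupersingularAssembly.lean`): the directory name repeats the summit name
set_option linter.dupNamespace false

noncomputable section

open scoped Classical

namespace Summit.BirchSwinnertonDyer.BirchSwinnertonDyer.Theorems

open WeierstrassCurve Literature.NumberTheory.EllipticCurves
  Literature.NumberTheory.EllipticCurves.ModularForms
  Literature.NumberTheory.EllipticCurves.Rank1Residual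
  Literature.NumberTheory.EllipticCurves.Rank1Residual.Typed
  Summit.BirchSwinnertonDyer.Rank1Residual
  Summit.BirchSwinnertonDyer.Rank1Residual.Additive
  Summit.BirchSwinnertonDyer.Rank1Residual.O6
  Summit.BirchSwinnertonDyer.BirchSwinnertonDyer.Theses.KatoDescentTamePotSupersingular

/-- **THE U₀ BILL v7 (item 19982 `TameUpperDefectRankZero`, type = the route decl).** Granted the Heegner-road
published facts (`hGZ`, `hKo`, `hMN`, `hnf`, `hBFH`), the route items `KatoTamagawaExactInputs` (`hK`, 19191),
`PublishedInputsFineSelmerCM` (`hF`, 19387), the deciding crux L₀ `TameLowerHalfRankZero` (`h₂`, 19981), the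
residual `TameRankOne` (`hR`, 19984) and the six HELD `…RedT` children of U₀-red (19203, via the closed glue 19712),
the KOLYVAGIN–JETCHEV SHARP INDEX BOUND on the non-CM ♯ rows with `ρ̄_{E,p}` not onto and a datum of level `N_E`
with `p ∤ c(D)` (`hJ`, displayed: at every Heegner field `K` of `E` with `d_K < −4` whose Heegner point `y_K` of
`D` has infinite order, `ord_p #Ш(E/K) + 2·ord_p ∏c_ℓ(E) ≤ 2·ord_p [E(K):ℤy_K]`), and Coates–Sujatha's (A) on the
MANIN-DIRTY rows only (`hCS`: non-CM, `ρ̄` not onto, no datum of level `N_E` with `p ∤ c`), U₀ holds. Compared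
with bill v6: crux 19413 is replaced by `hJ` on the ♯ rows (87 / 90 census rows: Jetchev's Thm. 1.4 in the
irreducible reading; 3: his Conj. 1.3) and by (A) on the Manin-dirty rows (census-empty). Composition: split glue
19204 ∘ (p471788 ⟹ 19202 body) ∘ (glue 19712 ⟹ 19203). Conditional; nothing asserted; no item is closed.
[cite: Jetchev2008, Thm. 1.4, Cor. 1.5, Rem. 6.2 (pp. 3, 15)] [cite: MatarNekovar2019, Thm. 0.3 (p. 456), §0.11 (p. 457)]
[cite: Kato2004Asterisque, Thm. 14.5 (3) (p. 236), (14.9.3) (p. 240), Prop. 14.16 (pp. 244–245)]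
[cite: CoatesSujatha2005, Conjecture A] [cite: Cassels1965ArithmeticVIII] -/
theorem tameUpperDefectRankZero_bill_of_sharpIndexBound_of_cruxAManin_of_heldItems
    (hGZ : ∀ (N : ℕ) [NeZero N] (W : WeierstrassCurve ℚ) (K : Type) [Field K] [NumberField K],
      gross_zagier N W K)
    (hKo : ∀ (N : ℕ) [NeZero N] (W : WeierstrassCurve ℚ) (K : Type) [Field K] [NumberField K],
      kolyvagin N W K)
    (hMN : ∀ (N : ℕ) [NeZero N] (W : WeierstrassCurve ℚ) (K : Type) [Field K] [NumberField K],
      MatarNekovar2019.thm03_padicValNat_card_sha_le_of_irreducible N W K)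
    (hnf : exists_isNewformOf) (hBFH : bumpFriedbergHoffstein_exists_heegnerField_split_twist_simpleZero)
    (hK : KatoTamagawaExactInputs) (hF : PublishedInputsFineSelmerCM) (h₂ : TameLowerHalfRankZero)
    (hR : TameRankOne)
    (hC₁ : PublishedInputIwasawaH1DataRedT) (hC₂ : PublishedInputNewformKatoRedT)
    (hC₃ : PublishedInputMemberHullCountInputsT) (hC₄ : PublishedInputCasselsIsogenyRedT)
    (hC₅ : PublishedInputRankEqAnalyticRankRedT) (hC₆ : PublishedInputEntireLFunctionRedT)
    (hJ : ∀ (W : WeierstrassCurve ℚ) [W.IsElliptic] [W.IsGloballyMinimal] (p : ℕ) [Fact p.Prime],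
      W.analyticRank = 0 → p ≠ 2 → Addv W p → SubTprime W p → ¬ W.HasCM →
      W.HasIrreducibleModPGaloisRep p → ¬ W.HasSurjectiveModNGaloisRep p → p ∣ W.tamagawaProduct →
      ∀ [NeZero (W.conductorNorm ℤ)] (D : ModularParametrizationData W (W.conductorNorm ℤ)),
        ¬ (p : ℤ) ∣ D.c →
        ∀ (K : Type) [Field K] [NumberField K], IsImaginaryQuadratic K →
          SatisfiesHeegnerHypothesis (W.conductorNorm ℤ) K → NumberField.discr K < -4 →
          ∀ (H : HeegnerDatum (W.conductorNorm ℤ) (NumberField.discr K)) (ι : K →+* ℂ)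
            (P : (W.baseChange K).toAffine.Point),
            WeierstrassCurve.Affine.Point.map ι.toRatAlgHom P = heegnerPointComplex D H →
            ¬ IsOfFinAddOrder P →
            padicValNat p (Nat.card (W.baseChange K).sha) + 2 * padicValNat p W.tamagawaProduct ≤
              2 * padicValNat p (AddSubgroup.zmultiples P).index)
    (hCS : ∀ (W : WeierstrassCurve ℚ) [W.IsElliptic] [W.IsGloballyMinimal] (p : ℕ) [Fact p.Prime],
      W.analyticRank = 0 → p ≠ 2 → Addv W p → SubTprime W p → ¬ W.HasCM →
      W.HasIrreducibleModPGaloisRep p → ¬ W.HasSurjectiveModNGaloisRep p →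
      (∀ [NeZero (W.conductorNorm ℤ)] (D : ModularParametrizationData W (W.conductorNorm ℤ)),
        (p : ℤ) ∣ D.c) →
      ∀ (κ : ZpExtension ℚ p), κ.IsCyclotomic →
        ∃ (γ : Field.absoluteGaloisGroup ℚ) (D : W.FineSelmerDualData κ γ),
          Module.Finite ℤ_[p] (RestrictScalars ℤ_[p] (IwasawaAlgebra p) D.X)) :
    Summit.BirchSwinnertonDyer.BirchSwinnertonDyer.Theses.KatoDescentTamePotSupersingular.TameUpperDefectRankZero :=
  tameUpperDefectOfSplit_proof
    (TameUpperHeegnerSharpRoad.upperNonsurjTower_of_lower_of_rankOne_of_sharpIndexBound_of_fineSelmerManin hGZ hKo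
      hMN hnf hBFH hK hF h₂ hR hJ hCS)
    (tameUpperReducibleDefectOfCountInputs_proof hC₁ hC₂ hC₃ hC₄ hC₅ hC₆) hK

end Summit.BirchSwinnertonDyer.BirchSwinnertonDyer.Theorems

end
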